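import Literature.MathematicalPhysics.QuantumFieldTheory.Balaban1983to89.T4StairWordPrefix
import Literature.MathematicalPhysics.QuantumFieldTheory.Balaban1983to89.T4WordSystemGaugeBound

/-!
# `Balaban1983to89.T4StairWordSystemCubeTree` — THE TREE-OF-BOXES WORD SYSTEM, I: sharp count boxes of a box rooted on its entry face, (INV) on a box's own bonds behind
# a hub word, and the CROSS-BOND CHAIN through an entry site, in the ONE-BOND-BOUND currency of `T4WordSystemGaugeBound.exists_gauge_one_on_nearFlat_of_bondBound`

Cell `pub-ymgap` (Track A DAG, node N12 = [B15] = T. Bałaban, *Large field renormalization. I*, Commun. Math. Phys. **122** (1989) 175–202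
[Balaban1989LargeFieldI]), width seat `dag-n12-w2` (g5), piece (R1) §3 (lane word dag-n12-c g19, cell bus l.37564: *«state the two-box lemma so that its OUTPUT is
again a word system … then box ∪ (tree of boxes) glued along a face iterates by the same lemma»*; LOCATED-GEOM v3 (3), l.38396: *«boxes: w6 §7; cube TREES: w2 (R1)»*).
Count-neutral Literature helper.  HONEST FRAMING: lattice ∕ gauge bookkeeping on the tree's own objects ([Balaban1987RG1] (0.3) staircase words, [Balaban1985Averaging]
(8) gauge transformation of parallel transport and (19)–(20) `|XY − 1| ≤ |X − 1| + |Y − 1|`, the located non-abelian Stokes bound of `LatticeWordStokesLocal`) and landed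
lemmas BY NAME; nothing of Bałaban's estimates ((1.7) ∕ (2.14) plaquette smallness, [15] Thm 1, Proposition 1, the datum side) is asserted; N12 is NOT discharged by this
file; one finite `𝕋⁴` programme at fixed `ε`; nothing here bears on the continuum ∕ OS ∕ mass-gap statement.

THE POINT.  Print normalises the minimiser locally (p. 194, the sentence after (1.77): *«The function is invariant with respect to the group of all gauge
transformations defined on Λ, hence it is natural to consider it on orbits of this group»*; [Balaban1985Averaging] (8): `U^u(x, x′) = u(x) U(x, x′) u⁻¹(x′)`).  The tree's
normaliser road (`T4WordSystemGaugeBound`) reads a ROOTED WORD SYSTEM; `T4StairWordPrefix.stairWordSystem_box` serves ONE parallelepiped; the sequel glues a child box `Q′`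
to a parent box `Q` through an ENTRY SITE `f = castSite f̃ ∈ Q` one layer outside `Q′` in the gluing axis `μ` (child words `w(f) ++ stairWord σ′ (x̃ − f̃)`, `μ` FIRST in `σ′`).
LOCATED-INTERFACE (3rd reading, this seat): a SINGLE hub for a face-crossing bond sits at the parent's nearest common ancestor and its symmetric count box overshoots by up to
`(M−1)∕2` in the parent's own entry axis and by `1–3` layers in `μ` AT ONCE (corner regions outside parent ∪ child ∪ grandparent); the zero-overshoot device is the CHAIN
through the entry site (§2), and chains compose only in the one-bond-bound currency.  So the invariant carried along the tree is, for `U` with `PlaqSmallOn S δ U`,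
(INV) `∀ ⟨s, s+e_ν⟩ with both ends in X: dist1 (𝒰_U(walk r (w s))·U(s, s+e_ν)·𝒰_U(walk r (w (s+e_ν)))⁻¹) ≤ K·δ` — the letter `hab` of
`T4WordSystemGaugeBound.exists_gauge_one_on_nearFlat_of_bondBound` (normaliser `u = 1` on `B`, holonomy gauge off `B`, `dist1 (U^u b) ≤ K·δ + η + ε₁`).  The constant does NOT
grow along the tree: a cross bond costs `|z|·K_Q + (|z| + 1 + |sw|)²∕4` with `K_Q` the PARENT BOX's own constant (`boxWords_bondBound`), never the running `K`.

WHAT IS PROVED (no `def`, no `sorry`; `G` any `GaugeGroup`):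
* §1 ★★ `stairWordSystem_box_rootAxis` — SHARP edition of `T4StairWordPrefix.stairWordSystem_box` (iii) (announced there as «not typed here»): with the root axis `μ₀`
  FIRST in `σ` every hub-reduced loop's count box lies in `[A − 1, B + 3]` in `μ₀` (no mirror half-box behind an entry-face root) and in `[min(A, 2r̃−B) − 1,
  max(B, 2r̃−A) + 3]` in the other axes; ★★ `boxWords_bondBound` — a box whose words are `ρ ++ stairWord σ (x̃ − h̃)` behind any hub word `ρ` with `walkEnd r ρ = castSite h̃`
  satisfies (INV) on its own bonds with `K_box(m) = (2(d(m+1)+1)+1)²∕4` as soon as that plaquette box lies in `S`.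
* §2 `walk_stairWord_mem_box` (a stair walk between two points of a box runs through bonds of the box), `count_crossLoop_le`, `crossBond_forced` ∕ `crossBond_forced'` (no
  wrapping across the glued pair; the gluing axis and the entry layer are FORCED by separation), ★★ `dist1_crossBond_le_of_entry` ∕ `dist1_crossBond_le_of_entry'` — THE
  CROSS-BOND CHAIN THROUGH AN ENTRY SITE `F`, both orientations, any gauge `g`: `g(s)·U(s,ν)·[g(F)·𝒰_F(sw)]⁻¹ = [𝒰_{U^g}(walk F z)]⁻¹ · g(F)·[𝒰_F(z)·U(s,ν)·𝒰_F(sw)⁻¹]·g(F)⁻¹`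
  ⇒ `≤ |z|·ε₁ + ((|z|+1+|sw|)²∕4)·δ` from a per-step bound `ε₁` on the bonds of `walk F z` under `U^g` and the located Stokes hypothesis of `z·(+e_ν)·swᵒᵖ` at `F`.
* (the sequel `T4StairWordSystemCubeTreeGlue`: ★★★ `treeGlue_crossBond_bondBound`, ★★★ `treeGlue_union_bondBound` — THE GLUING STEP assembled from §1–§2: endpoints,
  lengths, (INV) on the child's bonds, on the cross bonds (gluing axis and `f̃_μ` FORCED by separation), and on all bonds of `X ∪ Q′` with `max K (max K_box K_cross)`.)
HONEST SCOPE (LOCATED-GEOM v2 ∕ v3 unchanged): trees of parallelepipeds glued along faces, each new box touching the current union only through its parent box; ring-shaped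
`Ω₁(Z)` stay vacuous-by-shape (dag-n12-c's `B15Prop1HolonomyObstruction`); `⊆ Z^{(k)}` of the located boxes is the knit's collar inclusion, not proved here.

References: T. Bałaban, CMP 122 (1989) 175–202 [Balaban1989LargeFieldI] (p.193, p.194); CMP 98 (1985) 17–51 [Balaban1985Averaging] ((8)–(9) p.19, (19)–(20) p.21);
CMP 109 (1987) 249–301 [Balaban1987RG1] ((0.3) p.252); CMP 102 (1985) 277–309 [Balaban1985Variational] ((16)–(18) p.280).
-/

noncomputable section

open Set

namespace Literature.MathematicalPhysics.QuantumFieldTheory.Balaban1983to89.T4StairWordSystemCubeTree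

open T4Continuum T4ReflectionCone
open T4AxialGaugeSmallField (castSite castSite_apply castSite_add_e boxPlaqs castSite_injOn_box)
open B7Prop1Explicit (e e_apply)
open LatticeWordCountBox (walkEnd_castSite plaq_countBox_lt_of_plaqSmallOn_boxPlaqs)
open BlockAveragingPlaquetteBoundLocal (count_stairWord_le)
open T4StairWordPrefix (boxPlaqs_mono update_eq_add_e not_mem_post_of_mem_pre stairWord_update_decomp length_reducedLoop_stair_le
  count_reducedLoop_stair_le length_stairRuns_le count_wordRev' stairWordSystem_box)
open T4WordSystemGaugeBound (dist1_holAt_bond_le_of_words_hub dist1_holAt_le_length_mul holAt_bond_conj_of_commonPrefix)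
open T4ForestGaugeSameRootBound (dist1_holAt_bond_le_of_sameRoot_of_length_lt)

variable {P : Params} {j : ℕ}

/-! ## §1 ★★ The stair word system of a box with the ROOT AXIS FIRST: sharp count boxes; (INV) on the box's own bonds behind any hub word -/

section RootAxis

/-- ★★ **SHARP COUNT BOXES WITH THE ROOT AXIS FIRST** (the refinement of `T4StairWordPrefix.stairWordSystem_box` (iii) announced there): for the stair words
`stairWord σ (rep x − r̃)` of the non-wrapping box `castSite '' [A, B]` from a root `r̃ ∈ [A − 1, B + 1]`, with the axis `μ₀` FIRST in the order `σ`, every bond `⟨s, s + e_μ⟩`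
with both ends in the box has the common-prefix decomposition `p ++ v`, `p ++ v′` (`|v|, |v′| ≤ d·(m+1) + 1`) whose located Stokes hypothesis at the hub `walkEnd (castSite r̃) p`
follows from plaquette-smallness on the box `[A − 1, B + 3]` in the axis `μ₀` (the `μ₀`-run is always inside the common prefix or is the bond's own axis — no later run, so
the mirror half-box behind an entry-face root is never visited) and `[min(A, 2r̃ − B) − 1, max(B, 2r̃ − A) + 3]` in the other axes. [cite: Balaban1987RG1, (0.3) p.252; Balaban1985Averaging, (19)-(20) p.21] -/
theorem stairWordSystem_box_rootAxis (σ : Equiv.Perm (Fin P.d)) {μ₀ : Fin P.d} (hσ : ∃ rest, (List.finRange P.d).map σ = μ₀ :: rest)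
    {A B r : Fin P.d → ℤ} (hrA : A - 1 ≤ r) (hrB : r ≤ B + 1)
    (hN : ∀ κ, B κ - A κ + 3 < (P.sitesPerDir j : ℤ)) {m : ℕ} (hm : ∀ κ, B κ ≤ A κ + m)
    (rep : Site P j → Fin P.d → ℤ)
    (hrep : ∀ x ∈ (castSite '' Set.Icc A B : Set (Site P j)), A ≤ rep x ∧ rep x ≤ B ∧ (castSite (rep x) : Site P j) = x) :
    ∀ (s : Site P j) (μ : Fin P.d), s ∈ (castSite '' Set.Icc A B : Set (Site P j)) → s.shift μ ∈ (castSite '' Set.Icc A B : Set (Site P j)) →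
      ∃ p v v' : List (Letter P.d), stairWord σ (rep s - r) = p ++ v ∧ stairWord σ (rep (s.shift μ) - r) = p ++ v' ∧
        v.length ≤ P.d * (m + 1) + 1 ∧ v'.length ≤ P.d * (m + 1) + 1 ∧
        ∀ {G : Type*} [GaugeGroup G] (U : GaugeField P j G) (S : Set (Plaq P j)) (δ : ℝ), PlaqSmallOn S δ U →
          (boxPlaqs (fun κ => (if κ = μ₀ then A κ else min (A κ) (2 * r κ - B κ)) - 1)
              (fun κ => (if κ = μ₀ then B κ else max (B κ) (2 * r κ - A κ)) + 3) : Set (Plaq P j)) ⊆ S →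
          ∀ u : List (Letter P.d), (∀ l, u.count l ≤ (v ++ (μ, true) :: wordRev v').count l) →
            ∀ (a b : Fin P.d) (hab : a < b), dist1 (GaugeField.plaqHol U ⟨walkEnd (walkEnd (castSite r : Site P j) p) u, a, b, hab⟩) < δ := by
  intro s μ hs ht
  have hdisp : ∀ x ∈ (castSite '' Set.Icc A B : Set (Site P j)), ∀ κ, (rep x κ - r κ).natAbs ≤ m + 1 := by
    intro x hx κ
    have h1 : A κ ≤ rep x κ := (hrep x hx).1 κ; have h2 : rep x κ ≤ B κ := (hrep x hx).2.1 κ; have h5 : B κ ≤ A κ + m := hm κ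
    have h3 : A κ - 1 ≤ r κ := by have := hrA κ; rwa [Pi.sub_apply, Pi.one_apply] at this
    have h4 : r κ ≤ B κ + 1 := by have := hrB κ; rwa [Pi.add_apply, Pi.one_apply] at this
    omega
  set n : Fin P.d → ℤ := rep s - r with hn
  -- `rep (s + e_μ) = rep s + e_μ` (no wrapping on the box)
  have hrep' : rep (s.shift μ) = rep s + e μ := by
    have h1 := hrep s hs; have h2 := hrep _ ht
    have hcast : (castSite (rep (s.shift μ)) : Site P j) = castSite (rep s + e μ) := by
      rw [h2.2.2, castSite_add_e, h1.2.2]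
    refine castSite_injOn_box (lo := A) (hi := fun κ => B κ + 1) (fun κ => ?_) h2.1 (fun κ => ?_) (fun κ => ?_) (fun κ => ?_) hcast
    · have := hN κ; show B κ + 1 - A κ < _; linarith
    · have : rep (s.shift μ) κ ≤ B κ := h2.2.1 κ; show rep (s.shift μ) κ ≤ B κ + 1; linarith
    · have : A κ ≤ rep s κ := h1.1 κ; show A κ ≤ (rep s + e μ) κ; rw [Pi.add_apply, e_apply]; split_ifs <;> linarith
    · have : rep s κ ≤ B κ := h1.2.1 κ; show (rep s + e μ) κ ≤ B κ + 1; rw [Pi.add_apply, e_apply]; split_ifs <;> linarith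
  have hsμ : rep s μ + 1 ≤ B μ := by
    have h := (hrep _ ht).2.1 μ
    rw [hrep', Pi.add_apply, e_apply, if_pos rfl] at h
    exact h
  have hn' : rep (s.shift μ) - r = Function.update n μ (n μ + 1) := by
    rw [update_eq_add_e, hrep', hn]; abel
  obtain ⟨pre, post, p, ρs, ρt, hsplit, hνpre, hνpost, hpostnd, hws, hwt, hρ, hdispP⟩ := stairWord_update_decomp σ n μ
  have hρ' : (ρs = [] ∧ ρt = [(μ, true)]) ∨ (ρs = [(μ, false)] ∧ ρt = []) := by
    rcases hρ with ⟨-, h1, h2⟩ | ⟨-, h1, h2⟩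
    · exact Or.inl ⟨h1, h2⟩
    · exact Or.inr ⟨h1, h2⟩
  -- the root axis is in the common prefix or is the bond's axis
  have hroot : μ₀ = μ ∨ μ₀ ∈ pre := by
    obtain ⟨rest, hrest⟩ := hσ
    rw [hrest] at hsplit
    rcases pre with _ | ⟨a, pre'⟩
    · left; simp only [List.nil_append, List.cons.injEq] at hsplit; exact hsplit.1
    · right; simp only [List.cons_append, List.cons.injEq] at hsplit; rw [hsplit.1]; exact List.mem_cons_self
  have hc : ∀ κ, κ = μ → A κ ≤ r κ + netDisp p κ ∧ r κ + netDisp p κ ≤ B κ := by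
    intro κ hκ; subst hκ
    have h1 : A κ ≤ rep s κ := (hrep s hs).1 κ
    rw [hdispP κ, if_neg hνpre, if_pos rfl]
    rcases hρ with ⟨hnn, -, -⟩ | ⟨hneg, -, -⟩
    · rw [if_pos hnn, hn, Pi.sub_apply]; constructor <;> linarith
    · rw [if_neg (not_le.mpr hneg), hn, Pi.sub_apply]; constructor <;> linarith
  have hpostm : ∀ a ∈ post, (n a).natAbs ≤ m + 1 := fun a _ => hdisp s hs a
  have hL := length_reducedLoop_stair_le n μ post (m + 1) hpostm hρ'
  have hpostlen : post.length ≤ P.d := by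
    have h1 : (pre ++ μ :: post).length = P.d := by rw [← hsplit, List.length_map, List.length_finRange]
    rw [List.length_append, List.length_cons] at h1
    omega
  refine ⟨p, ρs ++ stairRuns n post, ρt ++ stairRuns n post, hws, by rw [hn', hwt], ?_, ?_, ?_⟩
  · exact hL.1.trans (by nlinarith)
  · exact hL.2.trans (by nlinarith)
  intro G _ U S δ hU hS
  have hcnt : ∀ (κ : Fin P.d) (b : Bool),
      ((((ρs ++ stairRuns n post) ++ (μ, true) :: wordRev (ρt ++ stairRuns n post)).count (κ, b) : ℕ) : ℤ)
        ≤ (if κ ∈ post then ((n κ).natAbs : ℤ) else 0) + (if κ = μ then 1 else 0) := by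
    intro κ b
    have h := count_reducedLoop_stair_le n μ hpostnd hνpost hρ' κ b
    have h' : ((((ρs ++ stairRuns n post) ++ (μ, true) :: wordRev (ρt ++ stairRuns n post)).count (κ, b) : ℕ) : ℤ)
        ≤ (((if κ ∈ post then (n κ).natAbs else 0) + (if κ = μ then 1 else 0) : ℕ) : ℤ) := by exact_mod_cast h
    refine h'.trans (le_of_eq ?_)
    split_ifs <;> push_cast <;> ring
  have hbounds : ∀ κ : Fin P.d,
      (if κ = μ₀ then A κ else min (A κ) (2 * r κ - B κ)) - 1
          ≤ (r κ + netDisp p κ) - (((ρs ++ stairRuns n post) ++ (μ, true) :: wordRev (ρt ++ stairRuns n post)).count (κ, false) : ℕ)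
      ∧ (r κ + netDisp p κ) + (((ρs ++ stairRuns n post) ++ (μ, true) :: wordRev (ρt ++ stairRuns n post)).count (κ, true) : ℕ) + 2
          ≤ (if κ = μ₀ then B κ else max (B κ) (2 * r κ - A κ)) + 3 := by
    intro κ
    have hf := hcnt κ false
    have ht' := hcnt κ true
    have h1 : A κ ≤ rep s κ := (hrep s hs).1 κ; have h2 : rep s κ ≤ B κ := (hrep s hs).2.1 κ
    have h3 : A κ - 1 ≤ r κ := by have := hrA κ; rwa [Pi.sub_apply, Pi.one_apply] at this
    have h4 : r κ ≤ B κ + 1 := by have := hrB κ; rwa [Pi.add_apply, Pi.one_apply] at this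
    have hA' : (if κ = μ₀ then A κ else min (A κ) (2 * r κ - B κ)) ≤ A κ := by split_ifs; exacts [le_rfl, min_le_left _ _]
    have hB' : B κ ≤ (if κ = μ₀ then B κ else max (B κ) (2 * r κ - A κ)) := by split_ifs; exacts [le_rfl, le_max_left _ _]
    have hnabs : ((n κ).natAbs : ℤ) = |rep s κ - r κ| := by rw [hn, Pi.sub_apply, Int.natCast_natAbs]
    by_cases hκμ : κ = μ
    · obtain ⟨hcl, hcu⟩ := hc κ hκμ
      have hκpost : κ ∉ post := hκμ ▸ hνpost
      rw [if_neg hκpost, if_pos hκμ] at hf ht'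
      constructor <;> linarith
    · by_cases hκpre : κ ∈ pre
      · have hκpost : κ ∉ post := not_mem_post_of_mem_pre σ hsplit hκpre
        rw [if_neg hκpost, if_neg hκμ] at hf ht'
        have hd : netDisp p κ = n κ := by rw [hdispP κ, if_pos hκpre]
        rw [hd, hn, Pi.sub_apply]
        constructor <;> linarith
      · -- a later axis: not the root axis
        have hκ0 : κ ≠ μ₀ := by
          rintro rfl
          rcases hroot with h | h
          · exact hκμ h
          · exact hκpre h
        have hd : netDisp p κ = 0 := by rw [hdispP κ, if_neg hκpre, if_neg hκμ]
        rw [hd, if_neg hκμ] at *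
        rw [if_neg hκ0, if_neg hκ0]
        have hmin2 : min (A κ) (2 * r κ - B κ) ≤ 2 * r κ - B κ := min_le_right _ _
        have hmin1 : min (A κ) (2 * r κ - B κ) ≤ A κ := min_le_left _ _
        have hmax1 : B κ ≤ max (B κ) (2 * r κ - A κ) := le_max_left _ _
        have hmax2 : 2 * r κ - A κ ≤ max (B κ) (2 * r κ - A κ) := le_max_right _ _
        have habs : (if κ ∈ post then ((n κ).natAbs : ℤ) else 0) ≤ |rep s κ - r κ| := by
          split_ifs
          · rw [hnabs]
          · exact abs_nonneg _
        rcases abs_cases (rep s κ - r κ) with ⟨ha, _⟩ | ⟨ha, _⟩ <;> constructor <;> linarith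
  have hhub : walkEnd (castSite r : Site P j) p = castSite (fun ν => r ν + netDisp p ν) := walkEnd_castSite r p
  refine plaq_countBox_lt_of_plaqSmallOn_boxPlaqs U _ (fun ν => r ν + netDisp p ν) hhub.symm _ hU
    (Set.Subset.trans (boxPlaqs_mono (fun κ => (hbounds κ).1) (fun κ => (hbounds κ).2)) hS)

/-- ★★ **(INV) ON A BOX'S OWN BONDS, BEHIND ANY HUB WORD**: if the words of the sites of the non-wrapping box `Q = castSite '' [A, B]` are `w x = ρ ++ stairWord σ (rep x − h̃)`
for a hub word `ρ` with `walkEnd r ρ = castSite h̃`, `h̃ ∈ [A − 1, B + 1]`, the axis `μ₀` first in `σ`, and the sharp plaquette box of `stairWordSystem_box_rootAxis` lies in a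
set `S` on which `U` has `δ`-small plaquettes, then (i) the words end at their sites, (ii) `|w x| ≤ |ρ| + d·(m+1)`, (iii) every bond `⟨s, s + e_ν⟩` with both ends in `Q` has
`dist1 (𝒰_U(walk r (w s))·U(s,ν)·𝒰_U(walk r (w (s+e_ν)))⁻¹) ≤ ((2(d(m+1)+1)+1)²∕4)·δ` — the prefix `ρ` conjugates away ((19)–(20)). [cite: Balaban1985Averaging, (19)-(20) p.21; Balaban1985Variational, (16)-(18) p.280] -/
theorem boxWords_bondBound {G : Type*} [GaugeGroup G] (U : GaugeField P j G) {S : Set (Plaq P j)} {δ : ℝ} (hδ : 0 ≤ δ) (hU : PlaqSmallOn S δ U)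
    (σ : Equiv.Perm (Fin P.d)) {μ₀ : Fin P.d} (hσ : ∃ rest, (List.finRange P.d).map σ = μ₀ :: rest)
    {A B h : Fin P.d → ℤ} (hhA : A - 1 ≤ h) (hhB : h ≤ B + 1)
    (hN : ∀ κ, B κ - A κ + 3 < (P.sitesPerDir j : ℤ)) {m : ℕ} (hm : ∀ κ, B κ ≤ A κ + m) (hmN : 2 * (P.d * (m + 1) + 1) + 1 < P.sitesPerDir j)
    (rep : Site P j → Fin P.d → ℤ)
    (hrep : ∀ x ∈ (castSite '' Set.Icc A B : Set (Site P j)), A ≤ rep x ∧ rep x ≤ B ∧ (castSite (rep x) : Site P j) = x)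
    (r : Site P j) (ρ : List (Letter P.d)) (hρ : walkEnd r ρ = castSite h)
    (w : Site P j → List (Letter P.d)) (hw : ∀ x ∈ (castSite '' Set.Icc A B : Set (Site P j)), w x = ρ ++ stairWord σ (rep x - h))
    (hS : (boxPlaqs (fun κ => (if κ = μ₀ then A κ else min (A κ) (2 * h κ - B κ)) - 1)
              (fun κ => (if κ = μ₀ then B κ else max (B κ) (2 * h κ - A κ)) + 3) : Set (Plaq P j)) ⊆ S) :
    (∀ x ∈ (castSite '' Set.Icc A B : Set (Site P j)), walkEnd r (w x) = x) ∧
    (∀ x ∈ (castSite '' Set.Icc A B : Set (Site P j)), (w x).length ≤ ρ.length + P.d * (m + 1)) ∧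
    ∀ (s : Site P j) (ν : Fin P.d), s ∈ (castSite '' Set.Icc A B : Set (Site P j)) → s.shift ν ∈ (castSite '' Set.Icc A B : Set (Site P j)) →
      dist1 (holAt U (walk r (w s)) * U ⟨s, ν⟩ * (holAt U (walk r (w (s.shift ν))))⁻¹) ≤ (((2 * (P.d * (m + 1) + 1) + 1 : ℕ) : ℝ) ^ 2 / 4) * δ := by
  obtain ⟨hend, hlen, -⟩ := stairWordSystem_box.{0} σ hhA hhB hN hm rep hrep
  have hend' : ∀ x ∈ (castSite '' Set.Icc A B : Set (Site P j)), walkEnd r (w x) = x := fun x hx => by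
    rw [hw x hx, walkEnd_append, hρ]; exact hend x hx
  refine ⟨hend', fun x hx => ?_, fun s ν hs ht => ?_⟩
  · rw [hw x hx, List.length_append]; exact Nat.add_le_add_left (hlen x hx) _
  obtain ⟨p, v, v', hps, hpt, hv, hv', hloc⟩ := stairWordSystem_box_rootAxis σ hσ hhA hhB hN hm rep hrep s ν hs ht
  refine dist1_holAt_bond_le_of_words_hub U r s ν w (ρ ++ p) v v' (by rw [hw s hs, hps, List.append_assoc])
    (by rw [hw _ ht, hpt, List.append_assoc]) (hend' s hs) (hend' _ ht) hv hv' hmN hδ fun u hu a b hab => ?_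
  rw [walkEnd_append, hρ]
  exact hloc U S δ hU hS u hu a b hab

end RootAxis

/-! ## §2 The cross-bond chain through an entry site -/

section Cross

/-- **A STAIR WALK BETWEEN TWO POINTS OF A BOX RUNS THROUGH BONDS OF THE BOX**: every step of `walk (castSite f̃) (stairWord σ (x̃ − f̃))`, `f̃, x̃ ∈ [A, B]`, has both ends in
`castSite '' [A, B]` (prefixes of a staircase stay in the coordinate box spanned by its ends: the tree's `netDisp_take_stairWord`). [cite: Balaban1987RG1, (0.3) p.252] -/
theorem walk_stairWord_mem_box (σ : Equiv.Perm (Fin P.d)) {A B f x : Fin P.d → ℤ} (hfA : A ≤ f) (hfB : f ≤ B) (hxA : A ≤ x) (hxB : x ≤ B) :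
    ∀ st ∈ walk (castSite f : Site P j) (stairWord σ (x - f)),
      st.bond.src ∈ (castSite '' Set.Icc A B : Set (Site P j)) ∧ st.bond.tgt ∈ (castSite '' Set.Icc A B : Set (Site P j)) := by
  intro st hst
  obtain ⟨k₁, k₂, h1, h2⟩ := BlockAveragingHaarAC.exists_take_of_mem_walk _ _ st hst
  have hbox : ∀ (k : ℕ) (κ : Fin P.d), A κ ≤ f κ + netDisp ((stairWord σ (x - f)).take k) κ ∧ f κ + netDisp ((stairWord σ (x - f)).take k) κ ≤ B κ := by
    intro k κ
    have h := netDisp_take_stairWord σ (x - f) κ k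
    have e1 := hfA κ; have e2 := hfB κ; have e3 := hxA κ; have e4 := hxB κ
    rw [Pi.sub_apply] at h
    rcases le_total 0 (x κ - f κ) with h0 | h0
    · rw [min_eq_left h0, max_eq_right h0] at h; constructor <;> linarith [h.1, h.2]
    · rw [min_eq_right h0, max_eq_left h0] at h; constructor <;> linarith [h.1, h.2]
  have hsrc : st.bond.src = castSite (fun κ => f κ + netDisp ((stairWord σ (x - f)).take k₁) κ) := by
    funext κ; rw [h1 κ]; simp only [castSite_apply]; push_cast; ring
  have htgt : st.bond.tgt = castSite (fun κ => f κ + netDisp ((stairWord σ (x - f)).take k₂) κ) := by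
    funext κ
    rw [PBond.tgt, Site.shift_apply]
    simp only [castSite_apply, h2 κ]
    split_ifs with hκ
    · rw [h1, ← hκ, castSite_apply]; push_cast; ring
    · rw [h1 κ, castSite_apply]; push_cast; ring
  exact ⟨⟨_, ⟨fun κ => (hbox k₁ κ).1, fun κ => (hbox k₁ κ).2⟩, hsrc.symm⟩, ⟨_, ⟨fun κ => (hbox k₂ κ).1, fun κ => (hbox k₂ κ).2⟩, htgt.symm⟩⟩

/-- **THE LETTER BUDGET OF THE CROSS LOOP** `stairWord σ n · (+e_ν) · (stairWord σ′ n′)ᵒᵖ` when `n′ = n` off `ν` and `{n_ν, n′_ν}` is `{0, 1}` or `{−1, 0}` (the two stair words from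
the entry site to the two ends of a bond along `ν` through the entry site's `ν`-layer): at most ONE letter of each sign in `ν`, at most `|n_κ|` in every other axis. [cite: Balaban1987RG1, (0.3) p.252] -/
theorem count_crossLoop_le {d : ℕ} (σ σ' : Equiv.Perm (Fin d)) (n n' : Fin d → ℤ) (ν : Fin d) (hoff : ∀ κ, κ ≠ ν → n' κ = n κ)
    (hν : (n ν = 0 ∧ n' ν = 1) ∨ (n ν = -1 ∧ n' ν = 0)) (κ : Fin d) (b : Bool) :
    (stairWord σ n ++ (ν, true) :: wordRev (stairWord σ' n')).count (κ, b) ≤ if κ = ν then 1 else (n κ).natAbs := by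
  rw [List.count_append, List.count_cons, count_wordRev']
  simp only [beq_iff_eq]
  have h1 := count_stairWord_le σ n κ b
  have h2 := count_stairWord_le σ' n' κ (!b)
  by_cases hκ : κ = ν
  · subst hκ
    rw [if_pos rfl]
    rcases hν with ⟨hn0, hn1⟩ | ⟨hn0, hn1⟩
    · rw [hn0] at h1; rw [hn1] at h2
      cases b <;> simp at h1 h2 ⊢ <;> omega
    · rw [hn0] at h1; rw [hn1] at h2
      cases b <;> simp at h1 h2 ⊢ <;> omega
  · have hne : ¬ ((ν, true) : Letter d) = (κ, b) := fun h => hκ (congrArg Prod.fst h).symm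
    rw [if_neg hκ, if_neg hne]
    rw [hoff κ hκ] at h2
    cases b <;> cases hd : decide (0 ≤ n κ) <;> simp [hd] at h1 h2 ⊢ <;> omega

/-- **NO WRAPPING ACROSS THE GLUED PAIR, AND THE GLUING GEOMETRY IS FORCED** (a bond from the parent box `[A, B]` INTO the child box `[A′, B′]`): if the two boxes are separated in
the axis `μ`, jointly non-wrapping, and `f̃_μ ∈ [A′_μ − 1, B_μ]`, then a bond `⟨castSite s̃, ν⟩` with `s̃ ∈ [A, B]` whose target is `castSite t̃`, `t̃ ∈ [A′, B′]`, has
`t̃ = s̃ + e_ν`, runs along `ν = μ`, starts in the entry site's `μ`-layer (`s̃_μ = f̃_μ`), and the child lies above (`B_μ < A′_μ`). [cite: Balaban1985Averaging, (3)-(5) p.18 (the torus as a quotient lattice; bookkeeping)] -/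
theorem crossBond_forced {A B A' B' f s t : Fin P.d → ℤ} {μ ν : Fin P.d}
    (hN : ∀ κ, max (B κ) (B' κ) + 1 - min (A κ) (A' κ) < (P.sitesPerDir j : ℤ))
    (hsep : B μ < A' μ ∨ B' μ < A μ) (hfB : f ≤ B) (hfA' : A' - 1 ≤ f)
    (hsA : A ≤ s) (hsB : s ≤ B) (htA : A' ≤ t) (htB : t ≤ B') (hcast : (castSite t : Site P j) = castSite (s + e ν)) :
    t = s + e ν ∧ ν = μ ∧ s μ = f μ ∧ B μ < A' μ := by
  have heq : t = s + e ν := by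
    refine castSite_injOn_box (lo := fun κ => min (A κ) (A' κ)) (hi := fun κ => max (B κ) (B' κ) + 1) (fun κ => ?_)
      (fun κ => ?_) (fun κ => ?_) (fun κ => ?_) (fun κ => ?_) hcast
    · have := hN κ; linarith
    · exact (min_le_right _ _).trans (htA κ)
    · exact (htB κ).trans ((le_max_right _ _).trans (by linarith))
    · show min (A κ) (A' κ) ≤ s κ + e ν κ
      have := hsA κ; rw [e_apply]; split_ifs <;> linarith [min_le_left (A κ) (A' κ)]
    · show s κ + e ν κ ≤ max (B κ) (B' κ) + 1
      have := hsB κ; rw [e_apply]; split_ifs <;> linarith [le_max_left (B κ) (B' κ)]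
  have htμ : t μ = s μ + e ν μ := by rw [heq, Pi.add_apply]
  have h1 := hsA μ; have h2 := hsB μ; have h3 := htA μ; have h4 := htB μ; have h5 := hfB μ
  have h6 : A' μ - 1 ≤ f μ := by have := hfA' μ; rwa [Pi.sub_apply, Pi.one_apply] at this
  rcases hsep with hsep | hsep
  · by_cases hνμ : ν = μ
    · subst hνμ
      rw [e_apply, if_pos rfl] at htμ
      exact ⟨heq, rfl, by linarith, hsep⟩
    · rw [e_apply, if_neg (Ne.symm hνμ)] at htμ
      exfalso; linarith
  · exfalso
    have h0 : (0 : ℤ) ≤ e ν μ := by rw [e_apply]; split_ifs <;> norm_num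
    linarith

/-- The mirror statement for a bond FROM the child box `[A′, B′]` into the parent box `[A, B]` (`f̃_μ ∈ [A_μ, B′_μ + 1]`): `t̃ = s̃ + e_ν`, `ν = μ`, the TARGET lies in the entry
site's `μ`-layer (`t̃_μ = f̃_μ`), and the child lies below (`B′_μ < A_μ`). [cite: Balaban1985Averaging, (3)-(5) p.18 (the torus as a quotient lattice; bookkeeping)] -/
theorem crossBond_forced' {A B A' B' f s t : Fin P.d → ℤ} {μ ν : Fin P.d}
    (hN : ∀ κ, max (B κ) (B' κ) + 1 - min (A κ) (A' κ) < (P.sitesPerDir j : ℤ))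
    (hsep : B μ < A' μ ∨ B' μ < A μ) (hfA : A ≤ f) (hfB' : f ≤ B' + 1)
    (hsA : A' ≤ s) (hsB : s ≤ B') (htA : A ≤ t) (htB : t ≤ B) (hcast : (castSite t : Site P j) = castSite (s + e ν)) :
    t = s + e ν ∧ ν = μ ∧ t μ = f μ ∧ B' μ < A μ := by
  have heq : t = s + e ν := by
    refine castSite_injOn_box (lo := fun κ => min (A κ) (A' κ)) (hi := fun κ => max (B κ) (B' κ) + 1) (fun κ => ?_)
      (fun κ => ?_) (fun κ => ?_) (fun κ => ?_) (fun κ => ?_) hcast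
    · have := hN κ; linarith
    · exact (min_le_left _ _).trans (htA κ)
    · exact (htB κ).trans ((le_max_left _ _).trans (by linarith))
    · show min (A κ) (A' κ) ≤ s κ + e ν κ
      have := hsA κ; rw [e_apply]; split_ifs <;> linarith [min_le_right (A κ) (A' κ)]
    · show s κ + e ν κ ≤ max (B κ) (B' κ) + 1
      have := hsB κ; rw [e_apply]; split_ifs <;> linarith [le_max_right (B κ) (B' κ)]
  have htμ : t μ = s μ + e ν μ := by rw [heq, Pi.add_apply]
  have h1 := hsA μ; have h2 := hsB μ; have h3 := htA μ; have h4 := htB μ; have h5 := hfA μ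
  have h6 : f μ ≤ B' μ + 1 := by have := hfB' μ; rwa [Pi.add_apply, Pi.one_apply] at this
  rcases hsep with hsep | hsep
  · exfalso
    have h0 : (0 : ℤ) ≤ e ν μ := by rw [e_apply]; split_ifs <;> norm_num
    linarith
  · by_cases hνμ : ν = μ
    · subst hνμ
      rw [e_apply, if_pos rfl] at htμ
      exact ⟨heq, rfl, by linarith, hsep⟩
    · rw [e_apply, if_neg (Ne.symm hνμ)] at htμ
      exfalso; linarith

variable {G : Type*} [GaugeGroup G]

/-- ★★ **THE CROSS-BOND CHAIN THROUGH AN ENTRY SITE** (generic; the child end is the TARGET): a gauge `g` on the parent's sites, an entry site `F`, a connecting word `z` from `F`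
to `s` whose steps are bonds on which `U^g` is `ε₁`-near `1`, and the child end gauged by `g(F)·𝒰_U(walk F sw)` with `walkEnd F sw = s + e_ν`.  Then
`g(s)·U(s,ν)·[g(F)·𝒰_F(sw)]⁻¹ = [𝒰_{U^g}(walk F z)]⁻¹ · g(F)·[𝒰_F(z)·U(s,ν)·𝒰_F(sw)⁻¹]·g(F)⁻¹` ([Balaban1985Averaging] (8) telescoped = the tree's `holAt_gaugeAct_walk`), so
`dist1 ≤ |z|·ε₁ + ((|z|+1+|sw|)²∕4)·δ` by (19)–(20), the transport bound `dist1_holAt_le_length_mul` and dag-n12-w6's same-root bound under the located Stokes hypothesis of the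
loop `z·(+e_ν)·swᵒᵖ` at `F`. [cite: Balaban1985Averaging, (8)-(9) p.19 and (19)-(20) p.21; Balaban1985Variational, (16)-(18) p.280] -/
theorem dist1_crossBond_le_of_entry (U : GaugeField P j G) (g : GaugeTransf P j G) (F s : Site P j) (ν : Fin P.d)
    (z sw : List (Letter P.d)) (hz : walkEnd F z = s) (hsw : walkEnd F sw = s.shift ν)
    {ε₁ δ : ℝ} (hε₁ : 0 ≤ ε₁) (hδ : 0 ≤ δ)
    (hsteps : ∀ st ∈ walk F z, dist1 (GaugeField.gaugeAct g U st.bond) ≤ ε₁)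
    (hlen : z.length + 1 + sw.length < P.sitesPerDir j)
    (hloc : ∀ u : List (Letter P.d), (∀ l, u.count l ≤ (z ++ (ν, true) :: wordRev sw).count l) →
      ∀ (a b : Fin P.d) (hab : a < b), dist1 (GaugeField.plaqHol U ⟨walkEnd F u, a, b, hab⟩) < δ) :
    dist1 (g s * U ⟨s, ν⟩ * (g F * holAt U (walk F sw))⁻¹) ≤ z.length * ε₁ + (((z.length + 1 + sw.length : ℕ) : ℝ) ^ 2 / 4) * δ := by
  have key : g s * U ⟨s, ν⟩ * (g F * holAt U (walk F sw))⁻¹ =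
      (holAt (GaugeField.gaugeAct g U) (walk F z))⁻¹ * (g F * (holAt U (walk F z) * U ⟨s, ν⟩ * (holAt U (walk F sw))⁻¹) * (g F)⁻¹) := by
    rw [holAt_gaugeAct_walk, hz]; group
  rw [key]
  have ht := dist1_holAt_le_length_mul (GaugeField.gaugeAct g U) hε₁ (walk F z) hsteps
  rw [T4WordSystemGaugeBound.length_walk'] at ht
  have hb := dist1_holAt_bond_le_of_sameRoot_of_length_lt U F s ν z sw hz hsw hlen hδ hloc
  calc dist1 ((holAt (GaugeField.gaugeAct g U) (walk F z))⁻¹ * (g F * (holAt U (walk F z) * U ⟨s, ν⟩ * (holAt U (walk F sw))⁻¹) * (g F)⁻¹))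
      ≤ dist1 (holAt (GaugeField.gaugeAct g U) (walk F z))⁻¹ + dist1 (g F * (holAt U (walk F z) * U ⟨s, ν⟩ * (holAt U (walk F sw))⁻¹) * (g F)⁻¹) :=
        GaugeGroup.dist1_mul_le _ _
    _ ≤ z.length * ε₁ + (((z.length + 1 + sw.length : ℕ) : ℝ) ^ 2 / 4) * δ := by
        rw [GaugeGroup.dist1_inv, GaugeGroup.dist1_conj]; exact add_le_add ht hb

/-- ★★ The same chain when the child end is the SOURCE: `[g(F)·𝒰_F(sw)]·U(s,ν)·g(s+e_ν)⁻¹ = g(F)·[𝒰_F(sw)·U(s,ν)·𝒰_F(z)⁻¹]·g(F)⁻¹ · 𝒰_{U^g}(walk F z)` with `walkEnd F sw = s`,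
`walkEnd F z = s + e_ν`. [cite: Balaban1985Averaging, (8)-(9) p.19 and (19)-(20) p.21; Balaban1985Variational, (16)-(18) p.280] -/
theorem dist1_crossBond_le_of_entry' (U : GaugeField P j G) (g : GaugeTransf P j G) (F s : Site P j) (ν : Fin P.d)
    (sw z : List (Letter P.d)) (hsw : walkEnd F sw = s) (hz : walkEnd F z = s.shift ν)
    {ε₁ δ : ℝ} (hε₁ : 0 ≤ ε₁) (hδ : 0 ≤ δ)
    (hsteps : ∀ st ∈ walk F z, dist1 (GaugeField.gaugeAct g U st.bond) ≤ ε₁)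
    (hlen : sw.length + 1 + z.length < P.sitesPerDir j)
    (hloc : ∀ u : List (Letter P.d), (∀ l, u.count l ≤ (sw ++ (ν, true) :: wordRev z).count l) →
      ∀ (a b : Fin P.d) (hab : a < b), dist1 (GaugeField.plaqHol U ⟨walkEnd F u, a, b, hab⟩) < δ) :
    dist1 ((g F * holAt U (walk F sw)) * U ⟨s, ν⟩ * (g (s.shift ν))⁻¹) ≤ z.length * ε₁ + (((sw.length + 1 + z.length : ℕ) : ℝ) ^ 2 / 4) * δ := by
  have key : (g F * holAt U (walk F sw)) * U ⟨s, ν⟩ * (g (s.shift ν))⁻¹ =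
      (g F * (holAt U (walk F sw) * U ⟨s, ν⟩ * (holAt U (walk F z))⁻¹) * (g F)⁻¹) * holAt (GaugeField.gaugeAct g U) (walk F z) := by
    rw [holAt_gaugeAct_walk, hz]; group
  rw [key]
  have ht := dist1_holAt_le_length_mul (GaugeField.gaugeAct g U) hε₁ (walk F z) hsteps
  rw [T4WordSystemGaugeBound.length_walk'] at ht
  have hb := dist1_holAt_bond_le_of_sameRoot_of_length_lt U F s ν sw z hsw hz hlen hδ hloc
  calc dist1 ((g F * (holAt U (walk F sw) * U ⟨s, ν⟩ * (holAt U (walk F z))⁻¹) * (g F)⁻¹) * holAt (GaugeField.gaugeAct g U) (walk F z))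
      ≤ dist1 (g F * (holAt U (walk F sw) * U ⟨s, ν⟩ * (holAt U (walk F z))⁻¹) * (g F)⁻¹) + dist1 (holAt (GaugeField.gaugeAct g U) (walk F z)) :=
        GaugeGroup.dist1_mul_le _ _
    _ ≤ (((sw.length + 1 + z.length : ℕ) : ℝ) ^ 2 / 4) * δ + z.length * ε₁ := by
        rw [GaugeGroup.dist1_conj]; exact add_le_add hb ht
    _ = _ := by ring

end Cross


end Literature.MathematicalPhysics.QuantumFieldTheory.Balaban1983to89.T4StairWordSystemCubeTree

end
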